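import Literature.AlgebraicGeometry.HodgeTheory.DworkSexticPencilChart
import Literature.AlgebraicGeometry.HodgeTheory.DworkSexticPencilHodgeLoci
import Literature.AlgebraicGeometry.HodgeTheory.DworkSexticDiagonalAveraging
import Literature.AlgebraicGeometry.HodgeTheory.IsoTransport
import Literature.AlgebraicGeometry.HodgeTheory.HodgeTypeConjugation
import Literature.AlgebraicGeometry.HodgeTheory.ComplexConjugationHolds
import HarnessLib

/-!
# Carlson–Griffiths residues along the Dwork pencil (Voisin II Cor. 6.12, Thm. 6.10, §6.1.3, Thm. 6.13 with
# Cor. 5.17; named fact) and the infinitesimal Noether–Lefschetz climb on the `Γ_W`-invariant piece (proved)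

Family `hodge`, layer `Literature/AlgebraicGeometry/HodgeTheory` (namespace `DworkSextic`). ONE named fact,
`Voisin2003_dworkPencil_residues_infinitesimal`: Griffiths' residue description of `F²H⁴` of the fibres of
the Dwork pencil `π : 𝒳 → D` (`DworkSextic.pencil`) at pole order `3`, in the tree's vocabulary and for the
fibre `𝒳_t` itself (residue map `res : ℂ[x₀,…,x₅] → H⁴(𝒳_t(ℂ); ℂ)`), with the five printed properties —
(i) `res(S₁₂) ⊆ F²` (Thm. 6.5/§6.1.3: pole order `3` ↦ `F^{4+1-3}`); (ii) `F² ⊆ res(S₁₂) + F³ + j_t^*H⁴(ℙ⁵)`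
(Cor. 6.12: `R_F^{12} ≅ H^{2,2}_prim`, and `H⁴ = H⁴_prim ⊕ ℂh²`); (iii) `res(J(F_t)₁₂) ⊆ F³` (Thm. 6.10,
the inclusion `J ⊆ ker ᾱ`); (iv) NATURALITY for the diagonal symmetries `a ∈ μ₆⁶`, `∏ aᵢ = 1`, of
`F_t = Σxᵢ⁶ − 6ψ∏xᵢ` (§6.1.3; `g_a^*Ω = (∏aᵢ)Ω = Ω`): `g^* res(P) = res(P(a·x))` for every continuous
self-map `g` of `𝒳_t(ℂ)` realising `[y] ↦ [a·y]`; (v) THE DERIVATIVE (Thm. 6.13, Carlson–Griffiths: `∇̄` is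
multiplication by the tangent polynomial, here `∂F_ψ/∂ψ = −6∏xᵢ`, read through Thm. 6.10 at pole order `4`;
with Cor. 5.17: a flat section staying in `F²` has `∇̄ = 0`): if `ξ|_{𝒳_{t'}} ∈ F²` for `t'` near `t` and
`ξ|_{𝒳_t} ≡ res(P)` modulo `F³ + j_t^*H⁴(ℙ⁵)`, then `(∏xᵢ)·P ∈ J(F_t)`.

PROVED from it (`Voisin2003_dworkPencil_invariantFlatSection_climb_of_residues`): the named fact
`DworkSextic.Voisin2003_dworkPencil_invariantFlatSection_climb` of `DworkSexticPencilHodgeLoci` — the `climb`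
input of the crux `GenericInvariantHodgeClasses` (stmt-HodgeConjecture-24129, route
`HodgeConjecture/DworkReflectionQuotients`). The proof is where the tree's invariant theory enters the kernel:
averaging the residue representative over `Γ_W` (`sum_gammaW_aeval_diagSubst`: the Reynolds operator lands on
the BALANCED part `P_bal`, using the algebraic symmetries `e⁻¹ ∘ diagIso ∘ e` of the fibre and their
compatibility with `j_t : 𝒳_t → ℙ⁵`), then `(∏xᵢ)·P_bal ∈ J ⇒ P_bal ∈ J`
(`prod_X_mul_mem_jacobianIdeal_iff`, the injectivity of `·∏xᵢ` on the invariant line of the Jacobian ring at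
EVERY `ψ`), whence `ξ|_{𝒳_t} ∈ F³ + j_t^*H⁴(ℙ⁵)` by (iii).

## References

* [VoisinHodgeII2003] C. Voisin, Hodge Theory and Complex Algebraic Geometry II (2003), §5.3.2 Cor. 5.17,
  §6.1.2 Thm. 6.5, Thm. 6.10, Cor. 6.12, §6.1.3 (naturality, `α_p`), §6.2.1 Thm. 6.13.
* [CarlsonGriffiths1980IVHS] J. Carlson, P. Griffiths, Infinitesimal variations of Hodge structure and the
  global Torelli problem (1980), §3.
* [Griffiths1969] P. Griffiths, On the periods of certain rational integrals I–II, Ann. of Math. 90 (1969), §8.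
* [Katz2009] N. M. Katz, Another look at the Dwork family, Progr. Math. 270 (2009), §3.
-/

noncomputable section

open CategoryTheory AlgebraicGeometry MvPolynomial
open _root_.Topology _root_.Filter
open scoped BigOperators

namespace Literature.AlgebraicGeometry.HodgeTheory.DworkSextic

open Literature.AlgebraicGeometry.Motives Literature.AlgebraicGeometry.Motives.UniversalHypersurface
open Literature.AlgebraicGeometry.HodgeTheory.UniversalHypersurface
open Literature.AlgebraicTopology.SingularHomology

/-! ### §1 The named fact: residues at pole order `3` along the pencil and their derivative -/

/-- **Carlson–Griffiths residues along the Dwork pencil** (Voisin II Thm. 6.5/§6.1.3, Cor. 6.12, Thm. 6.10,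
Thm. 6.13 with Cor. 5.17, for the fibres `𝒳_t ≅ X_{F_t}`, `F_t = Σxᵢ⁶ − 6ψ(t)∏xᵢ`, of `DworkSextic.pencil`).
For an open `B ⊆ D(ℂ)`, a tube class `ξ ∈ H⁴(π⁻¹B(ℂ); ℂ)` and `t ∈ B` there is a `ℂ`-linear RESIDUE MAP
`res : ℂ[x₀,…,x₅] → H⁴(𝒳_t(ℂ); ℂ)` (`P ↦ Res_{𝒳_t}[PΩ/F_t³]`, transported to the fibre) such that:
(i) `res P ∈ F²H⁴(𝒳_t)` for `P` homogeneous of degree `12`; (ii) every `x ∈ F²H⁴(𝒳_t)` is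
`res P + j_t^*θ` modulo `F³` for some such `P` and some `θ ∈ H⁴(ℙ⁵(ℂ); ℂ)` (`j_t = pencilFiberToProjectiveSpace t`);
(iii) `res P ∈ F³` for `P ∈ J(F_t)` homogeneous of degree `12`; (iv) `g^*(res P) = res(P(a·x))` for every
`a ∈ μ₆⁶` with `∏ aᵢ = 1` and every continuous self-map `g` of `𝒳_t(ℂ)` realising `[y] ↦ [a·y]` in the
coordinates of `j_t`; (v) if `ξ|_{𝒳_{t'}} ∈ F²` for all `t'` near `t` and `ξ|_{𝒳_t} − res P − j_t^*θ ∈ F³`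
(`P` homogeneous of degree `12`), then `(∏ xᵢ)·P ∈ J(F_t)` (`∇̄(ξ|_t mod F³) = 0`, `∇̄ res₃(P) = res₄(18∏xᵢ·P)`
modulo `F²`, and `ker(S₁₈ → Gr¹_F) = J(F_t)₁₈`).
`-- TODO(general form): Voisin II Thm. 6.13 for the universal family of hypersurfaces (∇̄ = multiplication`
`-- S^d ⊗ R^{a} → R^{a+d} under Griffiths' residues), of which this is the restriction to the Dwork line.`
[cite: VoisinHodgeII2003, §6.1.2 Thm. 6.5, Thm. 6.10, Cor. 6.12, §6.1.3 and §6.2.1 Thm. 6.13, §5.3.2 Cor. 5.17]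
[cite: CarlsonGriffiths1980IVHS, §3] [cite: Griffiths1969, §8] -/
def Voisin2003_dworkPencil_residues_infinitesimal : Prop :=
  ∀ (B : Set (ComplexPoints (baseSpz ℂ 4 6 pencilSpz))), IsOpen B →
    ∀ (ξ : singularCohomology ℂ ℂ (tubeOver pencil B) (2 * 2))
      (t : ComplexPoints (baseSpz ℂ 4 6 pencilSpz)) (ht : t ∈ B),
      ∃ res : MvPolynomial (Fin 6) ℂ →ₗ[ℂ] complexBetti (fiberOver pencil t) (2 * 2),
        (∀ P : MvPolynomial (Fin 6) ℂ, P.IsHomogeneous 12 →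
          IsInHodgeFiltration 4 (fiberOver pencil t) (2 * 2) 2 (res P)) ∧
        (∀ x : complexBetti (fiberOver pencil t) (2 * 2),
          IsInHodgeFiltration 4 (fiberOver pencil t) (2 * 2) 2 x →
          ∃ P : MvPolynomial (Fin 6) ℂ, P.IsHomogeneous 12 ∧
            ∃ θ : complexBetti (Literature.AlgebraicGeometry.Motives.projectiveSpace (4 + 1) ℂ) (2 * 2),
              IsInHodgeFiltration 4 (fiberOver pencil t) (2 * 2) 3
                (x - res P - complexBetti.map (pencilFiberToProjectiveSpace t) (2 * 2) θ)) ∧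
        (∀ P : MvPolynomial (Fin 6) ℂ, P.IsHomogeneous 12 →
          P ∈ jacobianIdeal (pointFormSpz ℂ 4 6 pencilSpz t) →
          IsInHodgeFiltration 4 (fiberOver pencil t) (2 * 2) 3 (res P)) ∧
        (∀ a : Fin 6 → ℂ, (∀ i, a i ^ 6 = 1) → ∏ i, a i = 1 →
          ∀ g : C(ComplexPoints (fiberOver pencil t), ComplexPoints (fiberOver pencil t)),
            (∀ y, ∃ s : ℂ, (hypersurfacePoint (pencilFiberToProjectiveSpace t) (g y)).rep =
                s • (a * (hypersurfacePoint (pencilFiberToProjectiveSpace t) y).rep)) →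
            ∀ P : MvPolynomial (Fin 6) ℂ,
              singularCohomology.map ℂ ℂ g (2 * 2) (res P) = res (aeval (ProjectiveSpace.diagSubst a) P)) ∧
        (∀ P : MvPolynomial (Fin 6) ℂ, P.IsHomogeneous 12 →
          ∀ θ : complexBetti (Literature.AlgebraicGeometry.Motives.projectiveSpace (4 + 1) ℂ) (2 * 2),
            (∀ᶠ t' in 𝓝 t, ∃ ht' : t' ∈ B,
              IsInHodgeFiltration 4 (fiberOver pencil t') (2 * 2) 2 (fiberRestrict pencil ht' (2 * 2) ξ)) →
            IsInHodgeFiltration 4 (fiberOver pencil t) (2 * 2) 3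
              (fiberRestrict pencil ht (2 * 2) ξ - res P -
                complexBetti.map (pencilFiberToProjectiveSpace t) (2 * 2) θ) →
            (∏ i : Fin 6, X i : MvPolynomial (Fin 6) ℂ) * P ∈ jacobianIdeal (pointFormSpz ℂ 4 6 pencilSpz t))

/-! ### §2 Transport lemmas -/

/-- **The Hodge filtration transports along isomorphisms of `ℂ`-schemes**: for `e : X ≅ X'`, if `e^* c'`
lies in `Fʳ` then so does `c'` (same Hodge model, analytification composed with `e(ℂ)`; the pattern of
`IsOfHodgeType.of_map_iso`). [cite: SerreGAGA1956, §2] -/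
theorem IsInHodgeFiltration.of_map_iso' {n : ℕ} {X X' : SchemeOver ℂ} (e : X ≅ X') {k r : ℕ}
    {c' : complexBetti X' k} (h : IsInHodgeFiltration n X k r (complexBetti.map e.hom k c')) :
    IsInHodgeFiltration n X' k r c' := by
  obtain ⟨A, hA⟩ := h
  let A' : HodgeModel n X' :=
    { A with
      toComplexPoints := Motives.AlgPoints.map e.hom ∘ A.toComplexPoints
      isAnalytification := A.isAnalytification.transport_iso e }
  refine ⟨A', ?_⟩
  have hc : (⟨A'.toComplexPoints, A'.isAnalytification.isHomeomorph.continuous⟩ :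
        C(A.carrier, Motives.ComplexPoints X')) =
      (Motives.AlgPoints.mapContinuous (L := ℂ) e.hom).comp
        ⟨A.toComplexPoints, A.isAnalytification.isHomeomorph.continuous⟩ :=
    ContinuousMap.ext fun _ ↦ rfl
  change singularCohomology.map ℂ ℂ
      (⟨A'.toComplexPoints, A'.isAnalytification.isHomeomorph.continuous⟩ :
        C(A.carrier, Motives.ComplexPoints X')) k c' ∈ A.hodgeFiltration k r
  rw [hc, singularCohomology.map_comp]
  exact hA

/-- The form of a point of the pencil base is the Dwork form of its parameter: `F_t = F_{ψ(t)}`.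
[cite: Katz2009, §3] -/
theorem pointFormSpz_eq_form_pencilParam (t : AlgPoints (baseSpz ℂ 4 6 pencilSpz) ℂ) :
    pointFormSpz ℂ 4 6 pencilSpz t = form (pencilParam t) := by
  conv_lhs => rw [← pencilPoint_pencilParam t]
  exact pointFormSpz_pencilPoint _

/-- Naturality of homogeneous coordinates in the embedding (`pt_{e ≫ ι}(y) = pt_ι(e y)`). [folklore] -/
private theorem hypersurfacePoint_comp_apply' {n : ℕ} {Y Y' : SchemeOver ℂ} (e : Y' ⟶ Y)
    (ι : Y ⟶ Literature.AlgebraicGeometry.Motives.projectiveSpace (n + 1) ℂ) (y : ComplexPoints Y') :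
    hypersurfacePoint (e ≫ ι) y = hypersurfacePoint ι (AlgPoints.map e y) := by
  unfold hypersurfacePoint
  rw [AlgPoints.map_comp_apply]

/-- **The algebraic diagonal symmetries of a fibre of the pencil**: for `t ∈ D(ℂ)` and `a ∈ μ₆⁶`, `∏ aᵢ = 1`,
there is an automorphism `φ` of `𝒳_t` over `ℂ` with `φ ≫ j_t = j_t ≫ diag(a)` on `ℙ⁵` whose map on complex
points realises `[y] ↦ [a·y]` in the coordinates of `j_t` (conjugate `DworkSextic.diagIso` by the fibre
isomorphism `𝒳_t ≅ X_{ψ(t)}` compatible with `ℙ⁵`). [cite: Katz2009, §3] -/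
theorem exists_fiber_diagAut (t : ComplexPoints (baseSpz ℂ 4 6 pencilSpz)) (a : Fin 6 → ℂ)
    (ha : ∀ i, a i ^ 6 = 1) (hap : ∏ i, a i = 1) :
    ∃ φ : fiberOver pencil t ≅ fiberOver pencil t,
      φ.hom ≫ pencilFiberToProjectiveSpace t =
        pencilFiberToProjectiveSpace t ≫ ProjectiveSpace.diagMap a (ne_zero_of_pow_six ha) ∧
      ∀ y, ∃ s : ℂ, (hypersurfacePoint (pencilFiberToProjectiveSpace t) (AlgPoints.map φ.hom y)).rep =
        s • (a * (hypersurfacePoint (pencilFiberToProjectiveSpace t) y).rep) := by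
  obtain ⟨e, he⟩ := exists_fiberIso_pencil_of_eq t (pointFormSpz_eq_form_pencilParam t)
  refine ⟨e ≪≫ diagIso (pencilParam t) a ha hap ≪≫ e.symm, ?_, fun y => ?_⟩
  · rw [Iso.trans_hom, Iso.trans_hom, Iso.symm_hom, Category.assoc, Category.assoc, ← he,
      e.inv_hom_id_assoc, diagIso_hom_comp_hypersurfaceι, ← Category.assoc]
  · have hpt : ∀ z, hypersurfacePoint (pencilFiberToProjectiveSpace t) z =
        pt (pencilParam t) (AlgPoints.map e.hom z) := fun z => by
      rw [← he, hypersurfacePoint_comp_apply']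
    obtain ⟨s, hs⟩ := exists_rep_pt_diagIso (pencilParam t) a ha hap (AlgPoints.map e.hom y)
    refine ⟨s, ?_⟩
    have hcomp : AlgPoints.map e.hom (AlgPoints.map (e.hom ≫ (diagIso (pencilParam t) a ha hap).hom ≫ e.inv) y) =
        AlgPoints.map (diagIso (pencilParam t) a ha hap).hom (AlgPoints.map e.hom y) := by
      rw [← AlgPoints.map_comp_apply, Category.assoc, Category.assoc, e.inv_hom_id, Category.comp_id,
        AlgPoints.map_comp_apply]
    rw [hpt, hpt, Iso.trans_hom, Iso.trans_hom, Iso.symm_hom, hcomp]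
    rw [AlgPoints.mapContinuous_apply] at hs
    exact hs

/-! ### §3 The climb on the invariant piece from the residue fact -/

/-- **The infinitesimal Noether–Lefschetz climb on the `Γ_W`-invariant piece follows from the
Carlson–Griffiths residue fact**: `Voisin2003_dworkPencil_residues_infinitesimal` implies the named fact
`Voisin2003_dworkPencil_invariantFlatSection_climb`. Given `ξ` flat near `t`, staying in `F²`, with
`x = ξ|_{𝒳_t}` invariant under the realised diagonal symmetries: (ii) writes `x ≡ res P + j^*θ (mod F³)`;
transporting along the algebraic symmetries `φ_a` (`exists_fiber_diagAut`, `F³` is preserved,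
`j^*θ ↦ j^*(diag(a)^*θ)`, `res P ↦ res(P∘a)` by (iv)) and averaging over `Γ_W` gives
`x ≡ res P_bal + j^*θ̄ (mod F³)` with `P_bal` the balanced part of `P` (`sum_gammaW_aeval_diagSubst`); (v)
gives `(∏xᵢ)·P_bal ∈ J(F_t)`, the invariant-line injectivity `prod_X_mul_mem_jacobianIdeal_iff` gives
`P_bal ∈ J(F_t)`, and (iii) gives `res P_bal ∈ F³`, so `x − j^*θ̄ ∈ F³`.
[cite: VoisinHodgeII2003, §6.2.1 Thm. 6.13 and §5.3.2 Cor. 5.17] [cite: Katz2009, §3] -/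
theorem Voisin2003_dworkPencil_invariantFlatSection_climb_of_residues
    (hR : Voisin2003_dworkPencil_residues_infinitesimal) :
    Voisin2003_dworkPencil_invariantFlatSection_climb := by
  classical
  intro B hBo ξ t ht hinv hev
  obtain ⟨res, h1, h2, h3, h4, h5⟩ := hR B hBo ξ t ht
  set x := fiberRestrict pencil ht (2 * 2) ξ with hxdef
  have hY : IsSmoothProjective 4 (fiberOver pencil t) := isSmoothProjectiveFamily_pencil.isSmoothProjective t
  obtain ⟨A⟩ := (nonempty_hodgeModel_holds (n := 4) (X := fiberOver pencil t)).nonempty hY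
  have hI := hodgePQ_independent_of_hodgeModel_holds
  -- `F³` as a submodule read in the model `A`
  have hF3 : ∀ c : complexBetti (fiberOver pencil t) (2 * 2),
      IsInHodgeFiltration 4 (fiberOver pencil t) (2 * 2) 3 c ↔
        c ∈ (A.hodgeFiltration (2 * 2) 3).comap (A.pullback (2 * 2)).hom :=
    fun c => hI.isInHodgeFiltration_iff hY A
  -- `x ∈ F²` (the flat section stays in `F²`, in particular at `t`)
  have hxF2 : IsInHodgeFiltration 4 (fiberOver pencil t) (2 * 2) 2 x := by
    obtain ⟨ht', h⟩ := hev.self_of_nhds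
    exact h
  obtain ⟨P, hP12, θ, hPθ⟩ := h2 x hxF2
  -- the algebraic symmetries and the transported congruences
  have hstep : ∀ a : gammaW,
      IsInHodgeFiltration 4 (fiberOver pencil t) (2 * 2) 3
        (x - res (aeval (ProjectiveSpace.diagSubst fun i => (((a : Fin (4 + 2) → ℂˣ) i : ℂˣ) : ℂ)) P) -
          complexBetti.map (pencilFiberToProjectiveSpace t) (2 * 2)
            (complexBetti.map (ProjectiveSpace.diagMap (fun i => (((a : Fin (4 + 2) → ℂˣ) i : ℂˣ) : ℂ))
              (ne_zero_of_pow_six (val_pow_six a))) (2 * 2) θ)) := by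
    intro a
    obtain ⟨φ, hφj, hφpt⟩ := exists_fiber_diagAut t _ (val_pow_six a) (prod_val_eq_one a)
    -- transport `x - res P - j^*θ ∈ F³` along `φ`
    have hT := IsInHodgeFiltration.of_map_iso' φ.symm (c' := complexBetti.map φ.hom (2 * 2)
      (x - res P - complexBetti.map (pencilFiberToProjectiveSpace t) (2 * 2) θ)) (by
        rw [Iso.symm_hom, ← ModuleCat.comp_apply, ← complexBetti.map_comp, φ.inv_hom_id, complexBetti.map_id,
          ModuleCat.id_apply]
        exact hPθ)
    have hgx : complexBetti.map φ.hom (2 * 2) x = x :=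
      hinv _ (val_pow_six a) (prod_val_eq_one a) (AlgPoints.mapContinuous (L := ℂ) φ.hom)
        (fun y => by rw [AlgPoints.mapContinuous_apply]; exact hφpt y)
    have hgres : complexBetti.map φ.hom (2 * 2) (res P) =
        res (aeval (ProjectiveSpace.diagSubst fun i => (((a : Fin (4 + 2) → ℂˣ) i : ℂˣ) : ℂ)) P) :=
      h4 _ (val_pow_six a) (prod_val_eq_one a) (AlgPoints.mapContinuous (L := ℂ) φ.hom)
        (fun y => by rw [AlgPoints.mapContinuous_apply]; exact hφpt y) P
    have hgθ : complexBetti.map φ.hom (2 * 2) (complexBetti.map (pencilFiberToProjectiveSpace t) (2 * 2) θ) =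
        complexBetti.map (pencilFiberToProjectiveSpace t) (2 * 2)
          (complexBetti.map (ProjectiveSpace.diagMap (fun i => (((a : Fin (4 + 2) → ℂˣ) i : ℂˣ) : ℂ))
            (ne_zero_of_pow_six (val_pow_six a))) (2 * 2) θ) := by
      rw [← ModuleCat.comp_apply, ← complexBetti.map_comp, hφj, complexBetti.map_comp, ModuleCat.comp_apply]
    rw [map_sub, map_sub, hgx, hgres, hgθ] at hT
    exact hT
  -- average over `Γ_W`
  set θbar : complexBetti (Literature.AlgebraicGeometry.Motives.projectiveSpace (4 + 1) ℂ) (2 * 2) :=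
    (Fintype.card gammaW : ℂ)⁻¹ • ∑ a : gammaW,
      complexBetti.map (ProjectiveSpace.diagMap (fun i => (((a : Fin (4 + 2) → ℂˣ) i : ℂˣ) : ℂ))
        (ne_zero_of_pow_six (val_pow_six a))) (2 * 2) θ with hθbar
  set Pbal : MvPolynomial (Fin 6) ℂ :=
    ∑ m ∈ P.support.filter (fun m => ∀ l : Fin 6, m l % 6 = m 0 % 6), monomial m (coeff m P) with hPbal
  have hcard : (Fintype.card gammaW : ℂ) ≠ 0 := Nat.cast_ne_zero.mpr Fintype.card_ne_zero
  have havg : IsInHodgeFiltration 4 (fiberOver pencil t) (2 * 2) 3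
      (x - res Pbal - complexBetti.map (pencilFiberToProjectiveSpace t) (2 * 2) θbar) := by
    rw [hF3]
    have hsum : (∑ a : gammaW, (x - res (aeval (ProjectiveSpace.diagSubst fun i =>
        (((a : Fin (4 + 2) → ℂˣ) i : ℂˣ) : ℂ)) P) -
          complexBetti.map (pencilFiberToProjectiveSpace t) (2 * 2)
            (complexBetti.map (ProjectiveSpace.diagMap (fun i => (((a : Fin (4 + 2) → ℂˣ) i : ℂˣ) : ℂ))
              (ne_zero_of_pow_six (val_pow_six a))) (2 * 2) θ))) ∈
        (A.hodgeFiltration (2 * 2) 3).comap (A.pullback (2 * 2)).hom :=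
      Submodule.sum_mem _ fun a _ => (hF3 _).mp (hstep a)
    have hsmul := Submodule.smul_mem _ ((Fintype.card gammaW : ℂ)⁻¹) hsum
    have heq : (Fintype.card gammaW : ℂ)⁻¹ • (∑ a : gammaW, (x - res (aeval (ProjectiveSpace.diagSubst fun i =>
        (((a : Fin (4 + 2) → ℂˣ) i : ℂˣ) : ℂ)) P) -
          complexBetti.map (pencilFiberToProjectiveSpace t) (2 * 2)
            (complexBetti.map (ProjectiveSpace.diagMap (fun i => (((a : Fin (4 + 2) → ℂˣ) i : ℂˣ) : ℂ))
              (ne_zero_of_pow_six (val_pow_six a))) (2 * 2) θ))) =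
        x - res Pbal - complexBetti.map (pencilFiberToProjectiveSpace t) (2 * 2) θbar := by
      rw [Finset.sum_sub_distrib, Finset.sum_sub_distrib, Finset.sum_const, Finset.card_univ, ← map_sum,
        ← map_sum, sum_gammaW_aeval_diagSubst, map_smul, hθbar, map_smul, smul_sub, smul_sub,
        ← Nat.cast_smul_eq_nsmul ℂ, smul_smul, inv_mul_cancel₀ hcard, one_smul, smul_smul,
        inv_mul_cancel₀ hcard, one_smul]
    rw [← heq]
    exact hsmul
  -- `(∏ xᵢ) · P_bal ∈ J(F_t)`, hence `P_bal ∈ J(F_t)` (invariant-line injectivity), hence `res P_bal ∈ F³`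
  have hPbal12 : Pbal.IsHomogeneous 12 := isHomogeneous_balancedPart hP12
  have huP : (∏ i : Fin 6, X i : MvPolynomial (Fin 6) ℂ) * Pbal ∈
      jacobianIdeal (pointFormSpz ℂ 4 6 pencilSpz t) := h5 Pbal hPbal12 θbar hev havg
  have hPJ : Pbal ∈ jacobianIdeal (pointFormSpz ℂ 4 6 pencilSpz t) := by
    rw [pointFormSpz_eq_form_pencilParam] at huP ⊢
    exact (prod_X_mul_mem_jacobianIdeal_iff (pencilParam t) (j := 2) (by norm_num)
      (balancedPart_support_degree hP12)).mp huP
  have hres3 := h3 Pbal hPbal12 hPJ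
  refine ⟨θbar, ?_⟩
  have hsum2 : x - complexBetti.map (pencilFiberToProjectiveSpace t) (2 * 2) θbar =
      (x - res Pbal - complexBetti.map (pencilFiberToProjectiveSpace t) (2 * 2) θbar) + res Pbal := by abel
  rw [hsum2, hF3]
  exact Submodule.add_mem _ ((hF3 _).mp havg) ((hF3 _).mp hres3)

end Literature.AlgebraicGeometry.HodgeTheory.DworkSextic

end
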